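import Summits.QuantumFields.BalabanUV.Beta.GAN24.DirichletExhaustion
import Literature.MathematicalPhysics.QuantumFieldTheory.Balaban1983to89.B6BondElimination

/-!
# `BalabanUV.Beta.GAN24.DirichletExhaustionElimZ` — binder row G-an2-4 / (CONV-C), part P2, PART 11 = skeleton node S2 (S2.0, S2.a, S2.b): Bałaban's
# p. 250 ELIMINATION `B = CB′` ([Balaban1984PropagatorsII] (2.154)–(2.156); axial trees Γ_{y,x} and pivots b₀(c) of [Balaban1984PropagatorsI]
# (1.10)–(1.11)) AS A KERNEL `elimZ L` ON THE BOND INDEX SET OF `ℤ^{d+1}` — the infinite-lattice twin of pv09-g6's torus matrix `B6Cov2156Torus.elimT`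
# built from b06-g3's site-level combinatorics (`corner`, `cOf`, `pivSite`, `mult`) BY NAME; entries bounded by 1, range L − 1, zero columns off the
# FREE bonds, free rows copy — input (in1) of the padded socket (PART 10) for Bałaban's `C` (unit b2b-balaban-gan24-p2, gen 1, v1)

HONEST FRAMING (cell contract, verbatim): «discharging `BetaPertH` makes Bałaban's UV stability UNCONDITIONAL — a real constructive-QFT result;
it is NOT the continuum limit and NOT the Clay problem.»  TYPING + bookkeeping; no analysis; nothing of the wall is touched; NOT `BetaPertH`, NOT
continuum, NOT Clay.  «not in print; our proof attempt».  READING (docstrings): a bond `(x, α)` = `⟨x, x + e_α⟩`; it is a TREE bond of its `L`-block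
iff it lies on the contour `Γ_{y,x′}` of some block point (b06's `IsTree` with ALL block corners admitted), a PIVOT iff it is the last unit bond of a
coarse bond `c` (b06's choice `pivSite`), FREE otherwise; `elimZ L p f` copies a free `f`, sets tree bonds to `0`, and solves the pivot of `c` from
`(QB)(c) = 0` with b06's multiplicities `mult` — literally `elimT`'s three branches with «faces» = all coarse bonds and «coarse sites» = all of `Lℤ^{d+1}`.

ABSOLUTE RULE (cell, verbatim): «No internally-minted statement may enter as a cited fact. Every hypothesis is either kernel-proved in this package
or a verbatim quotation of a PUBLISHED theorem with page reference. The manuscript(s) under audit are NOT citable for their own disputed steps — they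
are the thing under adjudication; programme-internal (2001/route/tribunal) claims are never citable.»

WHAT IS PROVED (0 sorry): `IsTreeZ`/`IsPivZ`/`IsFreeZ` (decidable), `elimZ`; `elimZ_of_not_free` (ZERO COLUMNS off the free bonds — why PART 10's padding is
needed), `elimZ_free_row` (free rows copy: `(CB′)_f = B′_f`), `abs_elimZ_le_one` (`mult ≤ L`, b06 `sum_mult_le_L`), `elimZ_eq_zero_of_dist` (range `L − 1`, b06
`dist_le_of_mult_ne_zero`), **`elimZ_bound`** (`|elimZ L r p| ≤ e^{δ(L−1)}·e^{−δ·dist}` for every `δ ≥ 0` — field `hC` of `CovInputPad`), `elimZ_iso` (S2.b: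
`Σ_{f free} v_f² ≤ Σ_r (Σ_f elimZ r f·v_f)²` on finite supports, from the free rows).  NOT here: the constraint identities `Q(CB′) = 0`, `(CB′)(Γ) = 0`
(S3.c/S4.b of the skeleton).  NOT summit progress.
-/

namespace Summit.QuantumFields.BalabanUV.Beta.GAN24.DirichletExhaustionElimZ

open Finset Real
open Literature.MathematicalPhysics.QuantumFieldTheory.Balaban1983to89
open B6Elimination (corner)
open B6BondElimination (unitVec pivSite cOf mult pivSite_cOf cOf_snd dist_le_of_mult_ne_zero sum_mult_le_L)
open B4Sect5Exhaustion (K)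

noncomputable section

variable {d : ℕ}

/-! ## §1 Tree bonds, pivots, free bonds on all of `ℤ^{d+1}` -/

/-- TREE bond of its block: `⟨x, x+e_α⟩ ⊂ Γ_{y,x′}` for the block corner `y = corner L x` — b06's `IsTree` with every block admitted
([Balaban1984PropagatorsI] (1.7)/(1.10): the contour moves in direction `α` only while the earlier coordinates are still at the corner). -/
def IsTreeZ (L : ℕ) (p : K (d + 1) (d + 1)) : Prop :=
  p.1 p.2 + 1 < corner L p.1 p.2 + L ∧ ∀ i, i < p.2 → p.1 i = corner L p.1 i

/-- `IsTreeZ` is decidable (finitely many integer comparisons). -/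
instance (L : ℕ) : DecidablePred (IsTreeZ (d := d) L) := fun p => by unfold IsTreeZ; infer_instance

/-- PIVOT bond: `⟨x, x+e_α⟩` is the last unit bond of the coarse bond `c = cOf L x α` and `c₋ ∈ Lℤ^{d+1}` (b06's `pivSite` convention). -/
def IsPivZ (L : ℕ) (p : K (d + 1) (d + 1)) : Prop := ∀ i, (L : ℤ) ∣ (cOf L p.1 p.2).1 i

/-- `IsPivZ` is decidable (finitely many divisibility tests). -/
instance (L : ℕ) : DecidablePred (IsPivZ (d := d) L) := fun p => by unfold IsPivZ; infer_instance

/-- FREE bond (a remaining variable `B′` of [Balaban1984PropagatorsII] p. 249): neither a tree bond nor a pivot. -/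
def IsFreeZ (L : ℕ) (p : K (d + 1) (d + 1)) : Prop := ¬ IsTreeZ L p ∧ ¬ IsPivZ L p

/-- `IsFreeZ` is decidable. -/
instance (L : ℕ) : DecidablePred (IsFreeZ (d := d) L) := fun p => by unfold IsFreeZ; infer_instance

/-! ## §2 The elimination kernel -/

/-- **Bałaban's elimination `B = CB′` as a kernel on `ℤ^{d+1} × Fin (d+1)`** (rows: all bonds `p`; columns: FREE bonds `f`, zero elsewhere):
a free bond is copied; a tree bond is `0` (`δ_{Ax}`); the pivot of `c` is solved from `δ((QB)(c))`: `B_{b₀(c)} = −L⁻¹ Σ_f mult_c(f) B′_f`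
— pv09-g6's `elimT` with all coarse bonds as faces. [cite: Balaban1984PropagatorsII, (2.154)–(2.156) pp.249–250] -/
def elimZ (L : ℕ) (p f : K (d + 1) (d + 1)) : ℝ :=
  if IsFreeZ L f then
    (if p = f then 1 else if IsTreeZ L p ∨ ¬ IsPivZ L p then 0 else -((mult L (cOf L p.1 p.2) f.1 f.2 : ℝ) / L))
  else 0

/-- **ZERO COLUMNS off the free bonds** (the eliminated variables are not columns of `C`). -/
theorem elimZ_of_not_free {L : ℕ} {p f : K (d + 1) (d + 1)} (hf : ¬ IsFreeZ L f) : elimZ L p f = 0 := by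
  unfold elimZ; rw [if_neg hf]

/-- **Free rows copy**: for a free bond `f`, `elimZ L f q = δ_{fq}` (so `(CB′)_f = B′_f`). -/
theorem elimZ_free_row {L : ℕ} {f : K (d + 1) (d + 1)} (hf : IsFreeZ L f) (q : K (d + 1) (d + 1)) :
    elimZ L f q = if f = q then 1 else 0 := by
  unfold elimZ
  by_cases hq : IsFreeZ L q
  · rw [if_pos hq]
    by_cases hfq : f = q
    · rw [if_pos hfq, if_pos hfq]
    · rw [if_neg hfq, if_neg hfq, if_pos (Or.inr hf.2)]
  · rw [if_neg hq]
    by_cases hfq : f = q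
    · exact absurd (hfq ▸ hf) hq
    · rw [if_neg hfq]

/-- The multiplicity of any unit bond in `(QB)(c)` is at most `L` (b06's `sum_mult_le_L` with the single coarse bond `c`). -/
theorem mult_le_L {L : ℕ} (hL : 0 < L) {c : (Fin (d + 1) → ℤ) × Fin (d + 1)} (hc : ∀ i, (L : ℤ) ∣ c.1 i)
    (z : Fin (d + 1) → ℤ) (ν : Fin (d + 1)) : mult L c z ν ≤ L := by
  have h := sum_mult_le_L hL (K := {c}) (fun c' hc' => by rw [Finset.mem_singleton] at hc'; subst hc'; exact hc) z ν
  simpa using h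

/-- **Entries are bounded by one.** -/
theorem abs_elimZ_le_one {L : ℕ} (hL : 0 < L) (p f : K (d + 1) (d + 1)) : |elimZ L p f| ≤ 1 := by
  unfold elimZ
  split_ifs with hf hpf htp
  · simp
  · simp
  · rw [not_or, not_not] at htp
    have hm : (mult L (cOf L p.1 p.2) f.1 f.2 : ℝ) ≤ L := by exact_mod_cast mult_le_L hL htp.2 f.1 f.2
    have hL' : (0 : ℝ) < L := by exact_mod_cast hL
    rw [abs_neg, abs_div, Nat.abs_cast, Nat.abs_cast, div_le_one hL']
    exact hm
  · simp

/-- **Finite range**: `elimZ L p f = 0` unless `dist p.1 f.1 ≤ L − 1` (a pivot row only sees the bonds occurring in its own `(QB)(c)`; b06's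
`dist_le_of_mult_ne_zero`). -/
theorem elimZ_eq_zero_of_dist {L : ℕ} (hL : 0 < L) {p f : K (d + 1) (d + 1)} (h : (L : ℝ) - 1 < dist p.1 f.1) : elimZ L p f = 0 := by
  unfold elimZ
  split_ifs with hf hpf htp
  · subst hpf; rw [dist_self] at h; have : (1 : ℝ) ≤ L := by exact_mod_cast hL
    linarith
  · rfl
  · by_contra hne
    have hm : mult L (cOf L p.1 p.2) f.1 f.2 ≠ 0 := by
      intro h0; apply hne; rw [h0, Nat.cast_zero, zero_div, neg_zero]
    have hd := dist_le_of_mult_ne_zero hL hm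
    rw [pivSite_cOf] at hd
    linarith
  · rfl

/-- **(in1) for Bałaban's `C`**: for every `δ ≥ 0`, `|elimZ L r p| ≤ e^{δ(L−1)}·e^{−δ·dist r.1 p.1}` (bounded entries + finite range). -/
theorem elimZ_bound {L : ℕ} (hL : 0 < L) {δ : ℝ} (hδ : 0 ≤ δ) (r p : K (d + 1) (d + 1)) :
    |elimZ L r p| ≤ Real.exp (δ * ((L : ℝ) - 1)) * Real.exp (-(δ * dist r.1 p.1)) := by
  by_cases h : (L : ℝ) - 1 < dist r.1 p.1
  · rw [elimZ_eq_zero_of_dist hL h, abs_zero]; positivity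
  · push Not at h
    refine (abs_elimZ_le_one hL r p).trans ?_
    rw [← Real.exp_add]
    exact Real.one_le_exp (by nlinarith)

/-! ## §3 S2.b: `C` is an isometric padding on the free coordinates -/

/-- On a finite set of rows `R` containing the free support `F` of `v`, `Σ_{f ∈ F} v_f² ≤ Σ_{r ∈ R} (Σ_{f ∈ F} elimZ r f·v_f)²`
(the free rows of `C` copy: `(CB′)_f = B′_f`). -/
theorem elimZ_iso {L : ℕ} (F R : Finset (K (d + 1) (d + 1))) (hF : ∀ f ∈ F, IsFreeZ L f) (hFR : F ⊆ R) (v : K (d + 1) (d + 1) → ℝ) :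
    ∑ f ∈ F, v f ^ 2 ≤ ∑ r ∈ R, (∑ f ∈ F, elimZ L r f * v f) ^ 2 := by
  classical
  have hrow : ∀ f ∈ F, ∑ g ∈ F, elimZ L f g * v g = v f := by
    intro f hf
    rw [Finset.sum_eq_single f]
    · rw [elimZ_free_row (hF f hf), if_pos rfl, one_mul]
    · intro g _ hgf
      rw [elimZ_free_row (hF f hf), if_neg (Ne.symm hgf), zero_mul]
    · intro h; exact absurd hf h
  calc ∑ f ∈ F, v f ^ 2 = ∑ f ∈ F, (∑ g ∈ F, elimZ L f g * v g) ^ 2 := Finset.sum_congr rfl fun f hf => by rw [hrow f hf]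
    _ ≤ ∑ r ∈ R, (∑ g ∈ F, elimZ L r g * v g) ^ 2 :=
        Finset.sum_le_sum_of_subset_of_nonneg hFR fun r _ _ => sq_nonneg _

end

end Summit.QuantumFields.BalabanUV.Beta.GAN24.DirichletExhaustionElimZ
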